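import Literature.NumberTheory.GaloisRepresentations.WeakAbelianDirectSummandCyclotomicProofs
import Literature.NumberTheory.GaloisRepresentations.FramedRepTwist
import Literature.NumberTheory.GaloisRepresentations.FramedRepTwistEulerFactorProofs
import Literature.NumberTheory.Automorphic.ReciprocityGLn
import HarnessLib

/-!
# The cyclotomic untwist `ρ ↦ ρ ⊗ χ_ℓ⁻¹` of a rank-3 framed Galois representation over `ℚ̄_ℓ`
(crux `IrreducibilityBySelfDuality.IrreducibleGL3CM`, item stmt-Langlands-14327, line
`reducible-companion-dispatch`, stub `stub_cyclotomicUntwist`)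

The summit `IrreducibleGL3CM` states Satake–Frobenius compatibility of `ρ : Γ_K → GL₃(ℚ̄_ℓ)` in the
L-normalisation `arithFrobPolyOfSatake ι q_v 1 α = ∏_{a ∈ α} (X - ι⁻¹(a⁻¹))` (no half-twist), while
the antecedent cruxes of the route use the C-normalisation `m = 3`:
`arithFrobPolyOfSatake ι q_v 3 α = ∏_{a ∈ α} (X - ι⁻¹(((√q_v)² a)⁻¹))`.  The bridge is the twist by the
inverse of the `ℓ`-adic cyclotomic character: with `ψ : Γ_K →ₜ* GL₁(ℚ̄_ℓ)` the `ℚ̄_ℓ`-valued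
cyclotomic character (`FramedGaloisRep.exists_cyclotomic_padicAlgCl`) and `χ = det ψ : Γ_K →ₜ* ℚ̄_ℓˣ`,
put `ρ' = ρ ⊗ χ⁻¹` (`FramedRep.twist`).  Then

* `ρ = ρ' ⊗ χ`, so `ρ'` irreducible ⇒ `ρ` irreducible (`FramedRep.isIrreducible_of_twist`);
* at `v ∤ ℓ`, `χ_ℓ(I_v) = 1` (`FramedGaloisRep.isUnramifiedAt_of_cyclotomic`), so `ρ'` is unramified
  wherever `ρ` is;
* at `v ∤ ℓ`, `χ_ℓ(Frob_v) = q_v` (`FramedGaloisRep.hasFrobCharpolyAt_natCast_of_cyclotomic`), so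
  `charpoly ρ'(Frob_v) = charpoly (q_v⁻¹ · ρ(Frob_v)) = ∏_{a ∈ α} (X - q_v⁻¹ ι⁻¹(a⁻¹))`
  (`charpoly_units_smul_of_charpoly_eq_prod`: rescaling a matrix by a unit rescales the roots of its
  characteristic polynomial), which is `arithFrobPolyOfSatake ι q_v 3 α` since `(√q_v)² = q_v` and
  `ι⁻¹` fixes the naturals.

The one general lemma is `charpoly_units_smul`: `det(X - cM) = cⁿ · det(X - M)(c⁻¹ X)` for a unit `c`
(both sides are determinants of the same matrix over `R[X]`; `RingHom.map_det` for `P ↦ P(c⁻¹ X)`,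
`Matrix.det_smul`).

References: J.-P. Serre, *Abelian ℓ-adic representations and elliptic curves* (1968), Ch. I §1.2
(the cyclotomic character: unramified away from `ℓ`, `χ_ℓ(Frob_v) = N v`); K. Buzzard, T. Gee,
*The conjectural connections between automorphic representations and Galois representations* (2014),
§2.1, Conj. 3.2.1–3.2.2 (L- versus C-normalisation, the twist by `|·|^{(1-n)/2}` ↔ `χ_ℓ^{(1-n)/2}`;
for `n = 3` the integer power `χ_ℓ⁻¹`).
-/

noncomputable section
open scoped NumberField
open Filter IsDedekindDomain Polynomial
open Literature.NumberTheory.Automorphic Literature.NumberTheory.GaloisRepresentations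

namespace Summit.Langlands.Langlands.Theorems.IrreducibleGL3CM

/-! ### Characteristic polynomial of a matrix rescaled by a unit -/

/-- **Rescaling a matrix by a unit rescales the variable of its characteristic polynomial**:
for a unit `c` of a commutative ring `R` and a square matrix `M`,
`det(X - cM) = c^n · det(X - M)(c⁻¹ X)`, i.e.
`(c • M).charpoly = C c ^ n * M.charpoly.comp (C c⁻¹ * X)` — both sides are the determinant of the
matrix `C c • (X·1 - M)(c⁻¹ X)` over `R[X]` (`RingHom.map_det` for the ring homomorphism
`P ↦ P ∘ (c⁻¹ X)`, `Matrix.det_smul`). [folklore] -/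
theorem charpoly_units_smul {R : Type*} [CommRing R] {m : Type*} [Fintype m] [DecidableEq m]
    (c : Rˣ) (M : Matrix m m R) :
    ((c : R) • M).charpoly =
      C (c : R) ^ Fintype.card m * M.charpoly.comp (C ((c⁻¹ : Rˣ) : R) * X) := by
  rw [Matrix.charpoly, Matrix.charpoly, ← Polynomial.coe_compRingHom_apply, RingHom.map_det,
    ← Matrix.det_smul]
  congr 1
  ext i j
  rw [Matrix.smul_apply, RingHom.mapMatrix_apply, Matrix.map_apply,
    Polynomial.coe_compRingHom_apply, smul_eq_mul]
  obtain rfl | hij := eq_or_ne i j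
  · rw [Matrix.charmatrix_apply_eq, Matrix.charmatrix_apply_eq, Matrix.smul_apply, smul_eq_mul,
      sub_comp, X_comp, C_comp, mul_sub, ← mul_assoc, ← C_mul, Units.mul_inv, C_1, one_mul,
      C_mul]
  · rw [Matrix.charmatrix_apply_ne _ _ _ hij, Matrix.charmatrix_apply_ne _ _ _ hij,
      Matrix.smul_apply, smul_eq_mul, neg_comp, C_comp, mul_neg, C_mul]

/-- **Rescaling by a unit rescales the roots**: if `M.charpoly = ∏_{r ∈ S} (X - r)` for a multiset
`S` of elements of a non-trivial commutative ring `R` and `c ∈ Rˣ`, then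
`(c • M).charpoly = ∏_{r ∈ S} (X - c r)` (from `charpoly_units_smul`: `card S = n` by degrees, and
`C c · (c⁻¹ X - r) = X - c r`). The every-rank form of the tree's rank-2
`charpoly_smul_of_charpoly_eq_fin_two`. [folklore] -/
theorem charpoly_units_smul_of_charpoly_eq_prod {R : Type*} [CommRing R] [Nontrivial R]
    {m : Type*} [Fintype m] [DecidableEq m] (c : Rˣ) {M : Matrix m m R} {S : Multiset R}
    (h : M.charpoly = (S.map fun r => X - C r).prod) :
    ((c : R) • M).charpoly = (S.map fun r => X - C ((c : R) * r)).prod := by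
  have hcard : Multiset.card S = Fintype.card m := by
    rw [← Matrix.charpoly_natDegree_eq_dim M, h, natDegree_multiset_prod_X_sub_C_eq_card]
  rw [charpoly_units_smul, h, multiset_prod_comp, Multiset.map_map, ← hcard,
    ← Multiset.prod_replicate, ← Multiset.map_const' S, ← Multiset.prod_map_mul]
  congr 1
  refine Multiset.map_congr rfl fun r _ => ?_
  show C (c : R) * (X - C r).comp (C ((c⁻¹ : Rˣ) : R) * X) = X - C ((c : R) * r)
  rw [sub_comp, X_comp, C_comp, mul_sub, ← mul_assoc, ← C_mul, Units.mul_inv, C_1, one_mul, C_mul]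

/-! ### The tree's two scalar embeddings `Aˣ → GL_n(A)` agree -/

/-- The tree's `FramedRep.scalar A n` (`Units.map` of `algebraMap A (Matrix (Fin n) (Fin n) A)`,
used by `FramedRep.twist`) and Mathlib's `Matrix.GeneralLinearGroup.scalar (Fin n)` (`Units.map` of
`Matrix.scalar`, used by `FramedRep.isIrreducible_of_twist`) are the same map `a ↦ a · 1`.
[folklore] -/
theorem scalar_eq_generalLinearGroup_scalar {A : Type*} [CommRing A] [TopologicalSpace A] {n : ℕ}
    (a : Aˣ) : FramedRep.scalar A n a = Matrix.GeneralLinearGroup.scalar (Fin n) a := by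
  refine Units.ext ?_
  rw [FramedRep.coe_scalar_apply, Matrix.GeneralLinearGroup.coe_scalar, Matrix.scalar_apply,
    Matrix.algebraMap_eq_diagonal]
  rfl

/-! ### The half-twist arithmetic: `ι⁻¹(((√q)² a)⁻¹) = q⁻¹ ι⁻¹(a⁻¹)` -/

/-- For a field isomorphism `ι : ℚ̄_ℓ ≃+* ℂ`, a natural number `q` and `a ∈ ℂ`:
`ι⁻¹(((√q)^{3-1} a)⁻¹) = q⁻¹ · ι⁻¹(a⁻¹)` in `ℚ̄_ℓ` (`(√q)² = q`, and `ι⁻¹` is multiplicative, commutes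
with inversion and fixes the naturals). [folklore] -/
theorem ringEquiv_symm_sqrt_pow_mul_inv {ℓ : ℕ} [Fact ℓ.Prime] (ι : PadicAlgCl ℓ ≃+* ℂ) (q : ℕ)
    (a : ℂ) :
    ι.symm (((Real.sqrt q : ℝ) : ℂ) ^ (3 - 1) * a)⁻¹ = ((q : PadicAlgCl ℓ))⁻¹ * ι.symm a⁻¹ := by
  have h2 : ((Real.sqrt q : ℝ) : ℂ) ^ (3 - 1) = (q : ℂ) := by
    rw [show (3 - 1 : ℕ) = 2 from rfl, ← Complex.ofReal_pow, Real.sq_sqrt (Nat.cast_nonneg q),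
      Complex.ofReal_natCast]
  rw [h2, mul_inv, map_mul, map_inv₀, map_natCast]

/-- **The `m = 3` Frobenius polynomial is the `m = 1` one with roots rescaled by `q⁻¹`**:
`arithFrobPolyOfSatake ι q 3 α = ∏_{a ∈ α} (X - q⁻¹ · ι⁻¹(a⁻¹))`, written over the multiset
`{ι⁻¹(a⁻¹) : a ∈ α}` of roots of `arithFrobPolyOfSatake ι q 1 α` (`arithFrobPolyOfSatake_one`).
Buzzard–Gee 2014, §2.1 (C- versus L-normalisation). [folklore] -/
theorem arithFrobPolyOfSatake_three {ℓ : ℕ} [Fact ℓ.Prime] (ι : PadicAlgCl ℓ ≃+* ℂ) (q : ℕ)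
    (α : Multiset ℂ) :
    arithFrobPolyOfSatake ι q 3 α =
      ((α.map fun a => ι.symm a⁻¹).map fun r => X - C (((q : PadicAlgCl ℓ))⁻¹ * r)).prod := by
  rw [arithFrobPolyOfSatake, Multiset.map_map]
  congr 1
  refine Multiset.map_congr rfl fun a _ => ?_
  show X - C (ι.symm (((Real.sqrt q : ℝ) : ℂ) ^ (3 - 1) * a)⁻¹) =
    X - C (((q : PadicAlgCl ℓ))⁻¹ * ι.symm a⁻¹)
  rw [ringEquiv_symm_sqrt_pow_mul_inv]

/-! ### The registered stub -/

/-- **Stub `stub_cyclotomicUntwist`** of the line `reducible-companion-dispatch` for the crux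
`IrreducibleGL3CM` (**the cyclotomic untwist**).  For every rank-3 framed Galois representation
`ρ : Γ_K →ₜ* GL₃(ℚ̄_ℓ)` of a number field `K` there is `ρ'` — namely `ρ' = ρ ⊗ χ_ℓ⁻¹`, the twist
(`FramedRep.twist`) by the inverse of (the determinant character of) the `ℚ̄_ℓ`-valued `ℓ`-adic
cyclotomic character `ψ` of `FramedGaloisRep.exists_cyclotomic_padicAlgCl` — such that:
`ρ'` irreducible ⇒ `ρ` irreducible (`ρ = ρ' ⊗ χ_ℓ`, `FramedRep.isIrreducible_of_twist`); and at every
finite place `v ∤ ℓ` where `ρ` is unramified, `ρ'` is unramified (`χ_ℓ(I_v) = 1`,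
`FramedGaloisRep.isUnramifiedAt_of_cyclotomic`) and a Frobenius characteristic polynomial
`arithFrobPolyOfSatake ι q_v 1 α = ∏ (X - ι⁻¹(a⁻¹))` of `ρ` becomes
`arithFrobPolyOfSatake ι q_v 3 α = ∏ (X - q_v⁻¹ ι⁻¹(a⁻¹))` for `ρ'` (`χ_ℓ(Frob_v) = q_v`,
`FramedGaloisRep.hasFrobCharpolyAt_natCast_of_cyclotomic`; `charpoly_units_smul_of_charpoly_eq_prod`,
`arithFrobPolyOfSatake_three`).  Serre 1968, Ch. I §1.2; Buzzard–Gee 2014, §2.1 and Conj. 3.2.1–3.2.2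
(passage between the L- and C-normalisations by a power of the cyclotomic character, integral for odd
`n`). [folklore] -/
theorem stub_cyclotomicUntwist : ∀ (K : Type) [Field K] [NumberField K] (ℓ : ℕ) [Fact ℓ.Prime] (ι : PadicAlgCl ℓ ≃+* ℂ) (ρ : FramedGaloisRep K (PadicAlgCl ℓ) 3), ∃ ρ' : FramedGaloisRep K (PadicAlgCl ℓ) 3, (ρ'.toGaloisRep.IsIrreducible → ρ.toGaloisRep.IsIrreducible) ∧ ∀ v : HeightOneSpectrum (𝓞 K), ((ℓ : ℕ) : 𝓞 K) ∉ v.asIdeal → ρ.IsUnramifiedAt v → ρ'.IsUnramifiedAt v ∧ ∀ α : Multiset ℂ, ρ.HasFrobCharpolyAt v (arithFrobPolyOfSatake ι v.residueCard 1 α) → ρ'.HasFrobCharpolyAt v (arithFrobPolyOfSatake ι v.residueCard 3 α) := by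
  intro K _ _ ℓ _ ι ρ
  -- the `ℚ̄_ℓ`-valued cyclotomic character `ψ` and its determinant character `χ = χ_ℓ : Γ_K →ₜ* ℚ̄_ℓˣ`
  obtain ⟨ψ, hψ⟩ := FramedGaloisRep.exists_cyclotomic_padicAlgCl K ℓ
  obtain ⟨χ, hχ⟩ : ∃ χ : Field.absoluteGaloisGroup K →ₜ* (PadicAlgCl ℓ)ˣ,
      ∀ σ : Field.absoluteGaloisGroup K, ((χ σ : (PadicAlgCl ℓ)ˣ) : PadicAlgCl ℓ) =
        ((ψ σ : GL (Fin 1) (PadicAlgCl ℓ)) : Matrix (Fin 1) (Fin 1) (PadicAlgCl ℓ)) 0 0 :=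
    ⟨FramedRep.det ψ, fun σ => by
      rw [FramedRep.det_apply, Matrix.GeneralLinearGroup.val_det_apply, Matrix.det_fin_one]⟩
  have hinv : ∀ σ : Field.absoluteGaloisGroup K, χ⁻¹ σ = (χ σ)⁻¹ := fun σ => rfl
  refine ⟨ρ.twist χ⁻¹, fun hirr => ?_, fun v hv hur => ⟨fun 𝔓 h𝔓 σ hσ => ?_, fun α hα 𝔓 h𝔓 σ hσ => ?_⟩⟩
  · -- irreducibility: `ρ = (ρ ⊗ χ⁻¹) ⊗ χ`
    refine FramedRep.isIrreducible_of_twist (ρ := ρ.twist χ⁻¹) (χ := χ) (fun g => ?_) hirr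
    rw [FramedRep.twist_apply, ← mul_assoc, scalar_eq_generalLinearGroup_scalar, ← map_mul, hinv,
      mul_inv_cancel, map_one, one_mul]
  · -- unramified at `v ∤ ℓ`: `χ_ℓ(I_v) = 1`
    have h1 : ψ σ = 1 := FramedGaloisRep.isUnramifiedAt_of_cyclotomic ψ hψ hv 𝔓 h𝔓 σ hσ
    have h2 : χ σ = 1 := Units.ext (by
      rw [hχ, h1, Units.val_one, Units.val_one, Matrix.one_apply_eq])
    rw [FramedRep.twist_apply_of_eq_one _ _ (by rw [hinv, h2, inv_one])]
    exact hur 𝔓 h𝔓 σ hσ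
  · -- Frobenius at `v ∤ ℓ`: `charpoly (q_v⁻¹ • ρ(Frob_v)) = ∏ (X - q_v⁻¹ ι⁻¹(a⁻¹))`
    have hq : ((ψ σ : GL (Fin 1) (PadicAlgCl ℓ)) : Matrix (Fin 1) (Fin 1) (PadicAlgCl ℓ)) 0 0 =
        (v.residueCard : PadicAlgCl ℓ) :=
      (FramedGaloisRep.hasFrobCharpolyAt_iff_of_rank_one ψ v _).mp
        (FramedGaloisRep.hasFrobCharpolyAt_natCast_of_cyclotomic ψ hψ hv) 𝔓 h𝔓 σ hσ
    have hc : ((χ⁻¹ σ : (PadicAlgCl ℓ)ˣ) : PadicAlgCl ℓ) = ((v.residueCard : PadicAlgCl ℓ))⁻¹ := by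
      rw [hinv, Units.val_inv_eq_inv_val, hχ, hq]
    have h1 : FramedRep.charpoly ρ σ = ((α.map fun a => ι.symm a⁻¹).map fun r => X - C r).prod := by
      rw [hα 𝔓 h𝔓 σ hσ, arithFrobPolyOfSatake_one, Multiset.map_map]
      rfl
    unfold FramedRep.charpoly at h1 ⊢
    rw [FramedRep.coe_twist_apply, charpoly_units_smul_of_charpoly_eq_prod (χ⁻¹ σ) h1, hc,
      arithFrobPolyOfSatake_three]

end Summit.Langlands.Langlands.Theorems.IrreducibleGL3CM

end
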